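import Summits.BirchSwinnertonDyer.BirchSwinnertonDyer.Theorems.KimAtThreeTwoExponentEnd
import Summits.BirchSwinnertonDyer.BirchSwinnertonDyer.Theorems.KimAtThreeDeepLowerDeepPortWith
import HarnessLib

/-!
# Crux `DeepLowerAtThreeOffKatoStratum` (item 19679), stub `stub_additiveDefect`, file 1/2: acc6's two-exponent
# END theorem one class deeper and its assembly on the shared-`η` deep family, GRANTED PORT₂ — route W2
# `KimAtThreeKolyvagin`, cell `bsd-addord`, seat `bsd-addord-w2-acc3` (PROGRAMME PART 1b row (3))

HONEST FRAMING. TOOL theorems only (no definition, no named fact, no `sorry`); nothing asserted, nothing booked,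
no mark moved; crux 19679 stays OPEN (its owner, the w2-c2 successor, assembles via
`Cruxes.DeepLowerAtThreeOffKatoStratum.Birth.DeepLowerAtThreeOffKatoStratum_of`).  This file and its sequel
`KimAtThreeDeepLowerOffStratumAdditiveDefectPortTwoExp` are the EULER-SYSTEM road for the LOWER stub on the
ADDITIVE-DEFECT rows (`Addv(3) ∧ (3 ∣ c₃ ∨ #E(ℚ₃)[3] ≠ 1 ∨ 3 ∣ c_{D₀})`): the two-exponent twin of w2-c2's
`KimAtThreeDeepLowerDeepPortWith2` (every `t`; one-exponent port PORT″, rows `3 ∤ c₃ ∧ 3 ∤ c_D`) written in acc6's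
`[0]⁺_f`-currency (`KimAtThreeTwoExponentEnd`; every defect exponent `e`; NO `3 ∤ c₃` / `3 ∤ c_P` / period
binder).  PRICE (by name, nothing asserted): the two S24-DEEP ports `hS24d`/`hS24d₂` (FLAG `S24-DEEP-PORT@3`), GZK
`hGZK`, Poitou–Tate `hPT` (named PUB facts), and ONE port — acc6's PORT₂
`KimAtThreeKolyvaginDefs.KatoKuriharaPortThreeAtWith₂TwoExp W t e v₃ η P` (FLAG `K22-Thm3.13-PORT@3`; value law
`3^e · Λ(loc κ_d) = u · 3^t · δ̃_{n(d)}`, in print `e = v₃(c₃) + v₃(c_P)`).  On these rows it REPLACES this seat's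
gen-0 BSD-currency residual {`N10.LowerHalfM`, `PotGoodLowerHalfRankZero`, TamManinDiv∞}
(`KimAtThreeDeepLowerOffStratumAdditiveDefect`, main-conjecture-grade) by {PORT₂, S24-DEEP}: the LOWER inequality
`∂⁽⁰⁾ ≤ ord₃ #Ш(3) + ∂^{(∞)}_deep` is the localisation-monotone half of Mazur–Rubin Thm. 5.2.12 and needs neither
a main conjecture nor the Tamagawa divisibility of deep Kurihara numbers.

* §1 `padicValRat_ratPlusSymbol_le_of_kolyvaginProduct_nested_twoExp_deep` — acc6's
  `KimAtThreeTwoExponentEnd.padicValRat_ratPlusSymbol_le_of_certificate_of_transport_nested_twoExp` read ONE CLASS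
  DEEPER (shallow datum on the class through `E[3^{c+1}]`, certificate at `n ∈ 𝒩_{c+1}`; w2-c2's §1 passage).
* §2 `padicValRat_ratPlusSymbol_le_of_towerSurj_deep_twoExp` — the assembly on w2-c2's shared-`η` deep family
  (`KimAtThreeDeepLowerDeepPortWith.exists_deepFamily_of_towerSurj_with`), dictionary unpacked from PORT₂:
  `ord₃ [0]⁺_{P.f} ≤ ord₃ #Ш(E/ℚ)(3) + (j − 1)` from a minimal certificate of modulus `3^j` at a cyclic
  `n ∈ 𝒩_{k+t+1}(E,3)`.
References: [Kim2025RefinedTNC] Thm 1.1, §8.1.2; [Kim2022StructureSelmer] Thm. 1.9 (6), Thm. 3.13, §3.2.3;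
[Sakamoto2024] Thm. 4.4; [MazurRubin2004] Thm. 3.2.4, 5.2.12, App. A (33); [MilneADT2006] I Thm. 4.10; cell memo
`run/shared/lean/pub/bsd-addord/kim3/KIM3-PROOF.md` §4.4, §14, §16.
-/

set_option autoImplicit false
-- the Theorems namespace of a single-conjunct summit repeats the summit name by design (D-0017)
set_option linter.dupNamespace false

noncomputable section

open scoped Classical NumberField ContRepresentation
open Function Field NumberField IsDedekindDomain IsDedekindDomain.HeightOneSpectrum WeierstrassCurve
  CongruenceSubgroup
  Literature.NumberTheory.EllipticCurves Literature.NumberTheory.EllipticCurves.ModularForms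
  Literature.NumberTheory.EllipticCurves.Rank1Residual
  Literature.NumberTheory.GaloisRepresentations
  Literature.NumberTheory.GaloisRepresentations.DiscreteGaloisModule Literature.NumberTheory.GaloisCohomology
  Rat.HeightOneSpectrum
  Summit.BirchSwinnertonDyer.Rank1Residual.GaloisImage
  Summit.BirchSwinnertonDyer.Rank1Residual.GaloisImage.Assembly
  Summit.BirchSwinnertonDyer.Rank1Residual.GaloisImage.S24Deep
  Summit.BirchSwinnertonDyer.Rank1Residual.X4
  Summit.BirchSwinnertonDyer.BirchSwinnertonDyer.Theorems.KimAtThreeKolyvaginUnitLevelOneRungs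
  Summit.BirchSwinnertonDyer.BirchSwinnertonDyer.Theorems.KimAtThreeKolyvaginCertificateDictionary
  Summit.BirchSwinnertonDyer.BirchSwinnertonDyer.Theorems.KimAtThreeKolyvaginMinimalCertificate
  Summit.BirchSwinnertonDyer.BirchSwinnertonDyer.Theorems.KimAtThreeDeepLowerKatoStratumOfFacts
  Summit.BirchSwinnertonDyer.BirchSwinnertonDyer.Theorems.KimAtThreeDeepLowerDeepPortWith
  Summit.BirchSwinnertonDyer.BirchSwinnertonDyer.Theorems.KimAtThreeKolyvaginDefs
  Summit.BirchSwinnertonDyer.BirchSwinnertonDyer.Theorems.KimAtThreeTwoExponentEnd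

namespace Summit.BirchSwinnertonDyer.BirchSwinnertonDyer.Theorems.KimAtThreeDeepLowerOffStratumAdditiveDefectPortTwoExpEnd

/-! ### §1 acc6's two-exponent END theorem, one class deeper (Kim's ℕ-currency certificate) -/

/-- **acc6's `padicValRat_ratPlusSymbol_le_of_certificate_of_transport_nested_twoExp` ONE CLASS DEEPER** — the
shallow datum `D` (depth `k`) lies on the DEEP Frobenius class through `E[3^{c+1}]` (any class exponent `c`;
`c = k + t` in use) and the certificate is read at `n ∈ 𝒩_{c+1}(E,3)` in Kim's ℕ-currency with ONE `ψ`: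
`ord₃ [0]⁺_{P.f} ≤ ord₃ #Ш(E/ℚ)(3) + (j − 1)`.  w2-c2's passage
`KimAtThreeDeepLowerDeepPortWith2.padicValRat_le_of_kolyvaginProduct_nested_at_deep` (bridge
`FrobShape.exists_level_of_kolyvaginProduct` one modulus up) applied to acc6's END; proof text verbatim otherwise
(credit seats w2-c2 / acc6 / kim3, cell b2b-bsdres n1011). [cite: Kim2022StructureSelmer, Thm. 1.9 (6), §1.2.2 and §1.4.3]
[cite: Sakamoto2024, §2 and Thm. 4.4] [cite: MazurRubin2004, Thm. 3.2.4, Thm. 4.4.1 and App. A (33)] -/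
theorem padicValRat_ratPlusSymbol_le_of_kolyvaginProduct_nested_twoExp_deep
    (W : WeierstrassCurve ℚ) [W.IsElliptic] [W.IsGloballyMinimal] (t e k c : ℕ)
    (D : KolyvaginDatum (W.torsionGaloisModule (((3 : ℕ) : ℤ) ^ k * ((3 : ℕ) : ℤ))))
    (v₃ : HeightOneSpectrum (𝓞 ℚ)) (hv₃ : ((3 : ℕ) : 𝓞 ℚ) ∈ v₃.asIdeal)
    -- the row
    (hadd : Addv W 3) (hsurj : W.HasSurjectiveModNGaloisRep ((3 : ℕ) : ℤ))
    (ht : Nat.card {Q : (W.baseChange ℚ_[3]).toAffine.Point // (3 : ℕ) • Q = 0} = 3 ^ t)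
    [Finite W.toAffine.Point] [Finite W.sha]
    {N : ℕ} [NeZero N] (P : ModularParametrizationData W N) (h0 : ratPlusSymbol P.f 0 ≠ 0)
    -- the shallow datum: cyclotomic transverse condition, a generator `g` of `KS₁`, and Sakamoto's
    -- Thm. 4.4 (2) in ORDER form at every level
    (hDT : D.transverse = cyclotomicTransverse _)
    (g : Finset (HeightOneSpectrum (𝓞 ℚ)) →
      galoisCohomology (W.torsionGaloisModule (((3 : ℕ) : ℤ) ^ k * ((3 : ℕ) : ℤ))) 1)
    (hg : g ∈ D.kolyvaginSystems (propagatedSelmerStructure W 3 k))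
    (hgen : ∀ κ ∈ D.kolyvaginSystems (propagatedSelmerStructure W 3 k), ∃ a : ℕ, κ = a • g)
    -- the deep inputs, at every depth `k′`
    (D' : ∀ k' : ℕ, KolyvaginDatum (W.torsionGaloisModule (((3 : ℕ) : ℤ) ^ k' * ((3 : ℕ) : ℤ))))
    (hDT' : ∀ k', (D' k').transverse = cyclotomicTransverse _)
    (hPP' : ∀ k', k ≤ k' → (D' k').primes ⊆ D.primes)
    (red : ∀ k' : ℕ, (W.torsionGaloisModule (((3 : ℕ) : ℤ) ^ k' * ((3 : ℕ) : ℤ))).toContRepresentation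
      →ⁱL (W.torsionGaloisModule (((3 : ℕ) : ℤ) ^ k * ((3 : ℕ) : ℤ))).toContRepresentation)
    (hred : ∀ k', ∀ x : geomTorsion W (((3 : ℕ) : ℤ) ^ k' * ((3 : ℕ) : ℤ)),
      ((red k' x : geomTorsion W (((3 : ℕ) : ℤ) ^ k * ((3 : ℕ) : ℤ))) : geomPoints W) =
        (((3 : ℕ) : ℤ) ^ (k' - k)) • (x : geomPoints W))
    (hdict : ∀ k', k ≤ k' → KatoKuriharaDictionaryThreeAt₂AtTwoExp W t e k k' D (D' k') (red k') v₃ P)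
    (g' : ∀ k' : ℕ, Finset (HeightOneSpectrum (𝓞 ℚ)) →
      galoisCohomology (W.torsionGaloisModule (((3 : ℕ) : ℤ) ^ k' * ((3 : ℕ) : ℤ))) 1)
    (hg' : ∀ k', g' k' ∈ (D' k').kolyvaginSystems (propagatedSelmerStructure W 3 k'))
    (hgo' : ∀ k', addOrderOf (g' k') = 3 ^ (k' + 1))
    (hgen' : ∀ k', ∀ κ ∈ (D' k').kolyvaginSystems (propagatedSelmerStructure W 3 k'),
      ∃ a : ℕ, κ = a • g' k')
    (inv' : ∀ k' : ℕ, LocalInvariants ℚ (3 ^ (k' + 1))) (hperf' : ∀ k', (inv' k').IsPerfect)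
    (hsum' : ∀ k', (inv' k').SumLocalTermEqZero) (hcompl' : ∀ k', (inv' k').SelmerComplement)
    (hinj' : ∀ k', ∀ v : HeightOneSpectrum (𝓞 ℚ), Injective (inv' k' (Sum.inr v)))
    (hEP : ∀ v : HeightOneSpectrum (𝓞 ℚ), localEulerPoincareCharacteristic (v.adicCompletion ℚ))
    (T : ∀ k' : ℕ, Finset (HeightOneSpectrum (𝓞 ℚ))) (hv₃T : ∀ k', v₃ ∈ T k')
    (hT : ∀ k', ∀ v : HeightOneSpectrum (𝓞 ℚ), v ∉ T k' →
      (((3 ^ (k' + 1) : ℕ) : ℕ) : 𝓞 ℚ) ∉ v.asIdeal ∧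
        GaloisRep.IsUnramifiedAt v (W.torsionGaloisModule (((3 : ℕ) : ℤ) ^ k' * ((3 : ℕ) : ℤ))))
    (h𝓕T : ∀ k', (propagatedSelmerStructure W 3 k').IsUnramifiedOutside (finSupport (T k')))
    (h𝓚T : ∀ k', (W.kummerSelmerStructure (((3 : ℕ) : ℤ) ^ k' * ((3 : ℕ) : ℤ))).IsUnramifiedOutside
      (finSupport (T k')))
    (hfinT : ∀ k', Finite (geomTorsion W (((3 : ℕ) : ℤ) ^ k' * ((3 : ℕ) : ℤ))))
    (hfinS : ∀ k', Finite (W.kummerSelmerStructure (((3 : ℕ) : ℤ) ^ k' * ((3 : ℕ) : ℤ))).selmerGroup)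
    -- the primes of the data lie off the admissible sets and have Rubin's local shape
    (hPS : ∀ q ∈ D.primes, q ∉ T k) (hPS' : ∀ k', ∀ q ∈ (D' k').primes, q ∉ T k')
    (hUT : ∀ q ∈ D.primes,
      Nat.card (unramifiedSubgroup (GaloisRep.toLocal q
        (W.torsionGaloisModule (((3 : ℕ) : ℤ) ^ k * ((3 : ℕ) : ℤ)))) 1) =
        Nat.card (D.transverse (Sum.inr q)))
    (hUT' : ∀ k', ∀ q ∈ (D' k').primes,
      Nat.card (unramifiedSubgroup (GaloisRep.toLocal q
        (W.torsionGaloisModule (((3 : ℕ) : ℤ) ^ k' * ((3 : ℕ) : ℤ)))) 1) =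
        Nat.card ((D' k').transverse (Sum.inr q)))
    -- Sakamoto's Thm. 4.4 (2) in ORDER form at every level, shallow and deep (S24-DEEP)
    (hR22D : ∀ d, D.IsLevel d →
      (Nat.card ((inv' k).dualSelmerStructure _
          (D.atLevel (propagatedSelmerStructure W 3 k) d)).selmerGroup ∣ 3 ^ (k + 1) →
        addOrderOf (g d) * Nat.card ((inv' k).dualSelmerStructure _
          (D.atLevel (propagatedSelmerStructure W 3 k) d)).selmerGroup = 3 ^ (k + 1)) ∧
      (3 ^ (k + 1) ∣ Nat.card ((inv' k).dualSelmerStructure _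
          (D.atLevel (propagatedSelmerStructure W 3 k) d)).selmerGroup → g d = 0))
    (hR22' : ∀ k' d, (D' k').IsLevel d →
      (Nat.card ((inv' k').dualSelmerStructure _
          ((D' k').atLevel (propagatedSelmerStructure W 3 k') d)).selmerGroup ∣ 3 ^ (k' + 1) →
        addOrderOf (g' k' d) * Nat.card ((inv' k').dualSelmerStructure _
          ((D' k').atLevel (propagatedSelmerStructure W 3 k') d)).selmerGroup = 3 ^ (k' + 1)) ∧
      (3 ^ (k' + 1) ∣ Nat.card ((inv' k').dualSelmerStructure _
          ((D' k').atLevel (propagatedSelmerStructure W 3 k') d)).selmerGroup → g' k' d = 0))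
    -- the shallow datum is a `τ`-datum on the DEEP class through `E[3^{c+1}]`; `ρ_{E,3^{c+1}}` onto
    {S : Set (HeightOneSpectrum (𝓞 ℚ))} {τ : absoluteGaloisGroup ℚ}
    (hτμ : τ ∈ rootsOfUnityFixer ℚ (3 ^ (c + 1)))
    (hτq : Nonempty (cokerSubOne (W.torsionGaloisModule (((3 : ℕ) : ℤ) ^ c * ((3 : ℕ) : ℤ))) τ ≃+
      ZMod (3 ^ (c + 1))))
    (hDP : D.primes = frobeniusClassPrimes
      (W.torsionGaloisModule (((3 : ℕ) : ℤ) ^ c * ((3 : ℕ) : ℤ))) S τ (3 ^ (c + 1)))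
    (hsurjK : W.HasSurjectiveModNGaloisRep (((3 : ℕ) : ℤ) ^ c * ((3 : ℕ) : ℤ)))
    -- the certificate in Kim's currency, at `n ∈ 𝒩_{c+1}`
    (n : ℕ) [NeZero n] (hn : Kato.IsKolyvaginProduct W 3 (c + 1) n)
    (hflag : ∀ v : HeightOneSpectrum (𝓞 ℚ), Ideal.absNorm v.asIdeal ∣ n →
      Nat.card (AddSubgroup.torsionBy (W.reductionAt v).toAffine.Point (3 : ℕ)) ≤ 3)
    (hnS : ∀ v : HeightOneSpectrum (𝓞 ℚ), Ideal.absNorm v.asIdeal ∣ n → v ∉ S)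
    (hnN : ∀ ℓ ∈ n.primeFactors, ¬ ℓ ∣ N) {j : ℕ} (htj : t + j ≤ k + 1)
    (ψ : (ℓ : ℕ) → (ZMod ℓ)ˣ →* Multiplicative (ZMod (3 ^ j)))
    (hψ : ∀ ℓ ∈ n.primeFactors, Function.Surjective (ψ ℓ))
    (hcert : kuriharaNumber P.f (3 ^ j) n ψ ≠ 0)
    (hv : ∀ d : ℕ, d ∣ n → 1 < d → d < n → ∀ [NeZero d], kuriharaNumber P.f (3 ^ j) d ψ = 0) :
    padicValRat 3 (ratPlusSymbol P.f 0) ≤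
      (padicValNat 3 (Nat.card (AddCommGroup.primaryComponent W.sha 3)) : ℤ) + ((j - 1 : ℕ) : ℤ) := by
  haveI : Fact (Nat.Prime 3) := ⟨Nat.prime_three⟩
  -- the places of `n` form a level of `D`
  obtain ⟨nF, hsub, hprod, hmem⟩ := FrobShape.exists_level_of_kolyvaginProduct W 3
    (Nat.succ_pos c) hn hflag (((3 : ℕ) : ℤ) ^ c * ((3 : ℕ) : ℤ)) (by push_cast; rw [pow_succ]) hsurjK
    hτμ hτq hnS
  have hlev : D.IsLevel nF := by
    change (↑nF : Set _) ⊆ D.primes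
    rw [hDP]
    exact hsub
  have hprime : ∀ q ∈ nF, (Ideal.absNorm q.asIdeal).Prime := fun q hq =>
    Nat.prime_of_mem_primeFactors (hmem q hq)
  have hinj := absNorm_injOn (↑nF : Set (HeightOneSpectrum (𝓞 ℚ)))
  have hn0 : n ≠ 0 := hn.ne_zero
  -- sub-products are divisors of `n`
  have hdvd : ∀ c' ⊆ nF, (∏ q ∈ c', Ideal.absNorm q.asIdeal) ∣ n := fun c' hc' => by
    rw [← hprod]; exact Finset.prod_dvd_prod_of_subset _ _ _ hc'
  refine padicValRat_ratPlusSymbol_le_of_certificate_of_transport_nested_twoExp W t e k D v₃ hv₃ hadd hsurj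
    ht P h0 hDT g hg hgen D' hDT' hPP' red hred hdict g' hg' hgo' hgen' inv' hperf' hsum' hcompl' hinj' hEP
    T hv₃T hT h𝓕T h𝓚T hfinT hfinS hPS hPS' hUT hUT' hR22D hR22' nF hlev htj ?_ (ψ₀ := ψ) ?_ ?_ ?_
  · -- `N q ∤ N`
    intro q hq
    exact (Nat.Prime.coprime_iff_not_dvd (hprime q hq)).mpr (hnN _ (hmem q hq))
  · exact fun q hq => hψ _ (hmem q hq)
  · -- the certificate at `n = ∏ N q`
    rw [kuriharaNumber_congr_level P.f (3 ^ j) hprod _ inferInstance ψ]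
    exact hcert
  · -- the proper non-empty sub-levels: proper divisors `1 < d < n`, any surjective `ψ′`
    intro c' hc' hne ψ' hψ'
    set d := ∏ q ∈ c', Ideal.absNorm q.asIdeal with hd
    have hd0 : d ≠ 0 := Finset.prod_ne_zero_iff.2 fun q _ => absNorm_ne_zero q
    haveI : NeZero d := ⟨hd0⟩
    have hdn : d ∣ n := hdvd c' hc'.subset
    have h1d : 1 < d := by
      obtain ⟨q₀, hq₀⟩ := hne
      have hle : Ideal.absNorm q₀.asIdeal ≤ d :=
        Nat.le_of_dvd (Nat.pos_of_ne_zero hd0) (Finset.dvd_prod_of_mem _ hq₀)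
      exact lt_of_lt_of_le (hprime q₀ (hc'.subset hq₀)).one_lt hle
    have hdlt : d < n := by
      have hsd : (nF \ c').Nonempty := Finset.sdiff_nonempty.mpr hc'.not_subset
      obtain ⟨q₁, hq₁⟩ := hsd
      have hsplit := Finset.prod_sdiff (f := fun q => Ideal.absNorm q.asIdeal) hc'.subset
      rw [hprod] at hsplit
      have h1 : 1 < ∏ q ∈ nF \ c', Ideal.absNorm q.asIdeal := by
        have hle : Ideal.absNorm q₁.asIdeal ≤ ∏ q ∈ nF \ c', Ideal.absNorm q.asIdeal :=
          Nat.le_of_dvd (Nat.pos_of_ne_zero (Finset.prod_ne_zero_iff.2 fun q _ => absNorm_ne_zero q))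
            (Finset.dvd_prod_of_mem _ hq₁)
        exact lt_of_lt_of_le (hprime q₁ (Finset.sdiff_subset hq₁)).one_lt hle
      calc d = 1 * d := (one_mul d).symm
        _ < (∏ q ∈ nF \ c', Ideal.absNorm q.asIdeal) * d := Nat.mul_lt_mul_of_pos_right h1
            (Nat.pos_of_ne_zero hd0)
        _ = n := hsplit
    have hzero : kuriharaNumber P.f (3 ^ j) d ψ = 0 := hv d hdn h1d hdlt
    -- `δ̃_d(ψ′) = u · δ̃_d(ψ)` for a unit `u`
    have hψd : ∀ ℓ ∈ d.primeFactors, Function.Surjective (ψ ℓ) := fun ℓ hℓ =>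
      hψ ℓ (Nat.primeFactors_mono hdn hn0 hℓ)
    have hψ'd : ∀ ℓ ∈ d.primeFactors, Function.Surjective (ψ' ℓ) :=
      Shallow.forall_primeFactors_of_forall_mem (fun q : HeightOneSpectrum (𝓞 ℚ) =>
        Ideal.absNorm q.asIdeal) c' (fun q hq => hprime q (hc'.subset hq)) (hinj.mono hc'.subset) hψ'
    obtain ⟨u, hu⟩ := exists_units_kuriharaNumber_eq_mul P.f (3 ^ j) d hψd hψ'd
    change kuriharaNumber P.f (3 ^ j) d ψ' = 0
    rw [hu, hzero, mul_zero]

/-! ### §2 The assembly on the shared-`η` deep family, GRANTED PORT₂ -/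

/-- **Cor C-t on `[0]⁺_f`, every `t`, every defect exponent `e`, every depth, GRANTED PORT₂.** `W/ℚ`
globally minimal, ADDITIVE at `3`, the `3`-adic tower onto, `#E(ℚ₃)[3] = 3^t`, `[0]⁺_{P.f} ≠ 0` (analytic rank
`0`), a parametrisation datum `P` (no Manin / period binder); GRANTED `hS24d`/`hS24d₂`, `hGZK`, `hPT`, generators
`η`, the two-exponent port `KatoKuriharaPortThreeAtWith₂TwoExp W t e v₃ η P`; a depth `k`, modulus `3^j`,
`t + j ≤ k + 1`, a MINIMAL certificate at a cyclic `n ∈ 𝒩_{k+t+1}(E,3)` with `ℓ ∤ N` for `ℓ ∣ n` ⟹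
`ord₃ [0]⁺_{P.f} ≤ ord₃ #Ш(E/ℚ)(3) + (j − 1)`.  Proof = w2-c2's
`exists_LOmega_padicValRat_le_of_towerSurj_deep_with₂` (credit seat w2-c2, cell b2b-bsdres n1011) on the shared-`η`
deep family, the dictionary unpacked from PORT₂, ending in §1.
[cite: Kim2022StructureSelmer, Thm. 1.9 (6) and Thm. 3.13] [cite: Sakamoto2024, Thm. 4.4 (p. 926)]
[cite: MazurRubin2004, §3.5 (H.5) (p. 27) and Prop. A.2 (pp. 79–80)] [cite: MilneADT2006, Ch. I, Thm. 4.10] -/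
theorem padicValRat_ratPlusSymbol_le_of_towerSurj_deep_twoExp
    (hS24d : S24Deep.kolyvaginSystems_freeRankOne_zmod_three_pow_deep)
    (hS24d₂ : S24Deep.kolyvaginSystems_idealOfBasis_eq_fittingIdeal_zmod_three_pow_deep)
    (hGZK : rank_eq_analyticRank_of_analyticRank_le_one)
    (hPT : poitouTate_selmerStructure_duality ℚ)
    (W : WeierstrassCurve ℚ) [W.IsElliptic] [W.IsGloballyMinimal] (t e k : ℕ)
    (hadd : haveI : Fact (Nat.Prime 3) := ⟨Nat.prime_three⟩; Addv W 3)
    (htower : ∀ m : ℕ, W.HasSurjectiveModNGaloisRep (3 ^ m : ℕ))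
    (ht : Nat.card {Q : (W.baseChange ℚ_[3]).toAffine.Point // (3 : ℕ) • Q = 0} = 3 ^ t)
    {N : ℕ} [NeZero N] (P : ModularParametrizationData W N) (h0 : ratPlusSymbol P.f 0 ≠ 0)
    (v₃ : HeightOneSpectrum (𝓞 ℚ)) (hv₃ : ((3 : ℕ) : 𝓞 ℚ) ∈ v₃.asIdeal)
    (η : (q : HeightOneSpectrum (𝓞 ℚ)) → (ZMod (Ideal.absNorm q.asIdeal))ˣ)
    (hη : ∀ q : HeightOneSpectrum (𝓞 ℚ), Subgroup.zpowers (η q) = ⊤)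
    (hPort : KatoKuriharaPortThreeAtWith₂TwoExp W t e v₃ η P)
    (n : ℕ) [NeZero n] (hn : Kato.IsKolyvaginProduct W 3 (k + t + 1) n)
    (hcyc : ∀ (ℓ : ℕ) [Fact ℓ.Prime], ℓ ∣ n →
      Nat.card {P : ((integralModelInt W).map (Int.castRingHom (ZMod ℓ))).toAffine.Point //
        3 • P = 0} ≤ 3)
    (hnN : ∀ ℓ ∈ n.primeFactors, ¬ ℓ ∣ N) {j : ℕ} (htj : t + j ≤ k + 1)
    (ψ : (ℓ : ℕ) → (ZMod ℓ)ˣ →* Multiplicative (ZMod (3 ^ j)))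
    (hψ : ∀ ℓ ∈ n.primeFactors, Function.Surjective (ψ ℓ))
    (hcert : kuriharaNumber P.f (3 ^ j) n ψ ≠ 0)
    (hv : ∀ d : ℕ, d ∣ n → 1 < d → d < n → ∀ [NeZero d], kuriharaNumber P.f (3 ^ j) d ψ = 0) :
    padicValRat 3 (ratPlusSymbol P.f 0) ≤
      (padicValNat 3 (Nat.card (AddCommGroup.primaryComponent W.sha 3)) : ℤ) + ((j - 1 : ℕ) : ℤ) := by
  haveI : Fact (Nat.Prime 3) := ⟨Nat.prime_three⟩
  have hL : W.entireLFunction 1 ≠ 0 :=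
    P.isNewformOf.entireLFunction_one_ne_zero_of_ratPlusSymbol_zero_ne_zero h0
  have hr : W.analyticRank = 0 := analyticRank_eq_zero_of_entireLFunction_one_ne_zero hL
  have hGZ := hGZK W (by rw [hr]; exact zero_le_one)
  haveI : Finite W.sha := hGZ.2
  haveI : Finite W.toAffine.Point := W.mordellWeilRank_eq_zero_iff_holds.mp (by rw [hGZ.1, hr])
  have hsurj : W.HasSurjectiveModNGaloisRep ((3 : ℕ) : ℤ) := by simpa using htower 1
  obtain ⟨inv, hperf, hsum, -, hcompl⟩ := hPT 3
  obtain ⟨inv', hperf', hsum', hcompl', hinj'⟩ := exists_localInvariants_three_pow_of_poitouTate hPT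
  have hEP : ∀ v : HeightOneSpectrum (𝓞 ℚ), localEulerPoincareCharacteristic (v.adicCompletion ℚ) :=
    localEulerPoincareCharacteristic_rat
  obtain ⟨T, h3T, hbadT, hTmem, hT, h𝓕T, h𝓚T, hfinT, hfinS⟩ := TowerPackage.towerAdmissible W
  have hS : ∀ w : InfinitePlace ℚ, (Sum.inl w : Place ℚ) ∈ finSupport T := inl_mem_finSupport T
  have h3S : ∀ v : HeightOneSpectrum (𝓞 ℚ), ((3 : ℕ) : 𝓞 ℚ) ∈ v.asIdeal →
      (Sum.inr v : Place ℚ) ∈ finSupport T := fun v hv => (inr_mem_finSupport_iff T v).mpr (h3T v hv)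
  have hbadS : ∀ v : HeightOneSpectrum (𝓞 ℚ), ¬ W.HasGoodReductionAt v →
      (Sum.inr v : Place ℚ) ∈ finSupport T := fun v hv => (inr_mem_finSupport_iff T v).mpr (hbadT v hv)
  have hSgood : ∀ v ∉ {v : HeightOneSpectrum (𝓞 ℚ) | (Sum.inr v : Place ℚ) ∈ finSupport T},
      W.HasGoodReductionAt v ∧ ((3 : ℕ) : 𝓞 ℚ) ∉ v.asIdeal := fun v hv =>
    ⟨by_contra fun h => hv (hbadS v h), fun h => hv (h3S v h)⟩
  have hSmem : ∀ v ∈ {v : HeightOneSpectrum (𝓞 ℚ) | (Sum.inr v : Place ℚ) ∈ finSupport T},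
      ¬ W.HasGoodReductionAt v ∨ ((3 : ℕ) : 𝓞 ℚ) ∈ v.asIdeal := fun v hv =>
    hTmem v ((inr_mem_finSupport_iff T v).mp hv)
  obtain ⟨τ, hτμ, hτq⟩ := S24Deep.exists_tau_forall_levels_of_towerSurj W htower
  obtain ⟨D', g', hP', hDT', hD', hPP', hPS', hUT', hg', hgo', hgen', hR22'⟩ :=
    exists_deepFamily_of_towerSurj_with W hS24d hS24d₂ t k htower τ hτμ hτq inv hperf hsum hcompl hEP
      (finSupport T) hS h3S hbadS hfinT η hη
  choose red hred using fun k' => exists_torsionReduction_three W k k'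
  -- With-guards for `η`, and the dictionary from PORT₂
  have hguard : ∀ k' m, m ≤ max k k' + t → (D' k').IsCanonicalTauDatumThreeAtWith W m k' η :=
    fun k' m hm => ⟨hDT' k', hD' k', _, τ, hSgood, hτμ _, hτq _, (hP' k').le.trans
      (S24Deep.frobeniusClassPrimes_torsion_pow_mul_mono W ((3 : ℕ) : ℤ) hm _ τ
        (pow_dvd_pow 3 (by omega)))⟩
  have hdict : ∀ k', k ≤ k' → KatoKuriharaDictionaryThreeAt₂AtTwoExp W t e k k' (D' k) (D' k') (red k') v₃ P :=
    fun k' _ => hPort k k' (D' k) (D' k') (red k') (hguard k (k + t) (by omega)) (hguard k' (k' + t) (by omega))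
  have hsurjK : W.HasSurjectiveModNGaloisRep (((3 : ℕ) : ℤ) ^ (max k k + t) * ((3 : ℕ) : ℤ)) := by
    simpa only [Nat.cast_pow, Nat.cast_mul, pow_succ] using htower (max k k + t + 1)
  have hn' : Kato.IsKolyvaginProduct W 3 (max k k + t + 1) n := by rw [max_self]; exact hn
  -- §1 at class exponent `max k k + t`, shallow datum `D′ k`
  exact padicValRat_ratPlusSymbol_le_of_kolyvaginProduct_nested_twoExp_deep W t e k (max k k + t) (D' k) v₃ hv₃
    hadd hsurj ht P h0 (hDT' k) (g' k) (hg' k) (hgen' k) D' hDT' (fun k' _ => hPP' k') red hred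
    hdict g' hg' hgo' hgen' inv' hperf' hsum' hcompl' hinj' hEP (fun _ => T) (fun _ => h3T v₃ hv₃) hT
    h𝓕T h𝓚T hfinT hfinS
    (fun q hq => fun h => hPS' k q hq ((inr_mem_finSupport_iff T q).mpr h))
    (fun k' q hq => fun h => hPS' k' q hq ((inr_mem_finSupport_iff T q).mpr h))
    (hUT' k) hUT'
    (fun d hd => hR22' k (inv' k) (hperf' k) (hsum' k) (hcompl' k) d hd)
    (fun k' d hd => hR22' k' (inv' k') (hperf' k') (hsum' k') (hcompl' k') d hd)
    (hτμ _) (hτq _) (hP' k) hsurjK n hn'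
    (fun v hv => natCard_torsionBy_reductionAt_le_of_dvd W 3 hcyc hv)
    (fun v hv h => by
      obtain ⟨hgood, h3⟩ := hasGoodReductionAt_and_not_mem_of_kolyvaginProduct W 3 hn hv
      rcases hSmem v h with hbad | h3v
      · exact hbad hgood
      · exact h3 h3v)
    hnN htj ψ hψ hcert hv

end Summit.BirchSwinnertonDyer.BirchSwinnertonDyer.Theorems.KimAtThreeDeepLowerOffStratumAdditiveDefectPortTwoExpEnd

end
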